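/- Copyright: the b2b-balaban cell (near-miss cell 7), T⁴-continuum fan-out, lineage t4-ne7b-p1 (node U5c COUNT
member).  Released under the licence of the surrounding project. -/
import Summits.QuantumFields.BalabanUV.T4Continuum.Support.HistoryGenealogyInstantiateWF

/-!
# INSTANTIATION FROM THE LEVEL SETS, part 3 (M3b-2 brick 4): the displayed clauses HOLD for print's construction,
and EVERY COMPONENT'S PEDIGREE IS PRINT-EXACTLY REALISED (owner module of row NE7b, lineage `t4-ne7b-p1` gen 40, ruling
R-OWNER-40-4; re-open object (α), `SCOPE-alpha.md` v2.2 §5 row M3b-2 — PRE-POSITIONING ONLY)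

Summits-side support leaf of the T⁴-continuum cell (rung (B)+1 on a FINITE torus only; NOT infinite volume, NOT the
mass gap, NOT the Clay statement; NOT a proof of the spine estimate NE7b, which is the cell's OWN estimate, NOT PRINTED
and NOT PROVED).  [folklore] finite combinatorics over bricks 3∕3b (`RunInput.St`, `hist`, `rnw`, `wf_hist`,
`St_nonempty_disjoint`, `constit_lab_newLine`, `enumB_spec`, `mem_parts_iff`), row S13-R (`pgenR` one-step equations,
`lastStep`), row S14-R (`edomR`, `LevelClausesR`, `realisesP_pgenR`), the print-exact core (`RealisesP`, `PendingBefore`,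
`Stops`); nothing printed is asserted, no `def … : Prop` fact of Bałaban's, no cite-tagged hypothesis, zero `sorry`.
B16 = [Balaban1989LargeFieldII] pp. 383–387, B15 = [Balaban1989LargeFieldI] p. 177: manuscripts UNDER AUDIT; the rules
instantiated are OUR reading (bricks 3∕3b docstrings); locators only (C-B16-6).

WHAT IS PROVED.  §1 shape lemmas (a block that is a single old line ∕ a single new region ∕ has two vertices ⟷ a
constituent list `[inl p]` ∕ `[inr n]` ∕ of length `≥ 2`), `rnw_lab_iff` (the flag of a live line's label is its own
renewal status).  §2 **THE INVARIANT `inv`**: for every line live at level `ℓ`, `t ≤ ℓ`, `(t, E) = ((pgenR ℓ (lab τ)).lastStep,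
edomR ℓ (lab τ))` — the construction's bookkeeping IS the extraction's — and `∀ k < ℓ − t, ¬ Stops L s R t E k` (a live
line has not been ready since its last event: it would have been integrated or renewed).  §3 **`levelClausesR_hist`**:
`LevelClausesR I.hist I.rnw domL I.L I.s I.R` — (G-new) = the input condition `NewOK`; (G-birth), (G-flow), (G-join) by
construction (a component's domain IS its block's union of images); (G-touch) by the chosen enumeration; (G-readyR):
flagged ⇒ renewed ⇒ ready, first time by the invariant; (G-pendR): an unflagged old vertex is alive and unrenewed ⇒
unready at its level, and unready before by the invariant.  §4 **`realisesP_hist`**: for every component `c` of level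
`ℓ` of the process, `RealisesP L s R (pgenR ℓ c) (edomR ℓ c)` and `c.2 = orbit L s (pgenR ℓ c).lastStep (edomR ℓ c)
(ℓ − lastStep)` (row S14-R's theorem applied), and **`disjoint_orbits_hist`** (distinct components of one level have
disjoint current domains = orbits) — THE (ID) READING'S GEOMETRIC HALF AS A THEOREM about an explicitly defined process:
from (flow, new regions with (G-new), new-field cubes) alone, print's rules produce pedigrees realised in row S1b's
print-exact sense, pairwise disjoint at every cutoff, with NO displayed clause left but (G-new).

HONEST.  Proves nothing of Bałaban's; that Bałaban's large-field regions of (2.18)∕(1.72) ARE the output of `St` for the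
run's (N, F) is the residual reading for M2∕M4; NE7b NOT proved; spine 0∕9.  HONEST DEPENDENCY (cell): continuum YM on
T⁴ ⇐ BetaPertH ∧ nine spine estimates (0/9 proved); BetaPertH ⇐ (D1) ∧ (D4) ∧ CAP+tail; G-an2-4 gates asym, D1 and
NE2/3/4.  This file changes none of it. -/

open Finset
open Literature.MathematicalPhysics.QuantumFieldTheory.Balaban1983to89
open Literature.MathematicalPhysics.QuantumFieldTheory.Balaban1983to89.B13ScaleTransfer
open Literature.MathematicalPhysics.QuantumFieldTheory.Balaban1983to89.B16SProfile
open Literature.MathematicalPhysics.QuantumFieldTheory.Balaban1983to89.B16MergeGeometry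
open Summit.QuantumFields.BalabanUV.T4Continuum.HistoryAdmissible
open Summit.QuantumFields.BalabanUV.T4Continuum.HistoryRealise
open Summit.QuantumFields.BalabanUV.T4Continuum.HistoryRealisePrint
open Summit.QuantumFields.BalabanUV.T4Continuum.HistoryGenealogyExtraction
open Summit.QuantumFields.BalabanUV.T4Continuum.HistoryGenealogyRealise
open Summit.QuantumFields.BalabanUV.T4Continuum.HistoryTouchComponents

namespace Summit.QuantumFields.BalabanUV.T4Continuum.HistoryGenealogyInstantiate

noncomputable section

open Classical

variable {d : ℕ}

/-! ## §1 Shape lemmas -/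

/-- a duplicate-free list whose members are exactly `v` is `[v]` [folklore] -/
theorem list_eq_singleton_of_nodup {α : Type*} {l : List α} {v : α} (hnd : l.Nodup) (hmem : ∀ x, x ∈ l ↔ x = v) :
    l = [v] := by
  match l, hnd, hmem with
  | [], _, hmem => exact absurd ((hmem v).2 rfl) (by simp)
  | [a], _, hmem => rw [(hmem a).1 (by simp)]
  | a :: b :: l, hnd, hmem =>
      have ha : a = v := (hmem a).1 (by simp)
      have hb : b = v := (hmem b).1 (by simp)
      rw [List.nodup_cons] at hnd
      exact absurd (by rw [ha, hb]; simp) hnd.1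

/-- a list containing two distinct members has length `≥ 2` [folklore] -/
theorem two_le_length_of_mem_ne {α : Type*} {l : List α} {v w : α} (hv : v ∈ l) (hw : w ∈ l) (hne : v ≠ w) :
    2 ≤ l.length := by
  match l, hv, hw with
  | [], hv, _ => simp at hv
  | [a], hv, hw =>
      simp only [List.mem_singleton] at hv hw
      exact absurd (hv.trans hw.symm) hne
  | _ :: _ :: _, _, _ => simp

/-- `assembleR` of at least two constituents has last step `s` [folklore] -/
theorem lastStep_assembleR_of_two_le {γ : Type*} (c : γ) (s : ℕ) {L : List (PGen γ)} (h : 2 ≤ L.length) :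
    (assembleR c s L).lastStep = s := by
  match L, h with
  | [], h => simp at h
  | [_], h => simp at h
  | T :: U :: L, _ => rw [assembleR_cons_cons]; exact lastStep_joinTail_cons T U L s

/-- `lonePartR` of a list of length `≥ 2` is `none` [folklore] -/
theorem lonePartR_eq_none_of_two_le (rnw : ℕ → Lab d → Bool) (j : ℕ) {l : List (Lab d ⊕ Lab d)} (h : 2 ≤ l.length) :
    lonePartR rnw j l = none := by
  match l, h with
  | [], h => simp at h
  | [_], h => simp at h
  | x :: _ :: _, _ => cases x <;> rfl

namespace RunInput

variable (I : RunInput d)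

/-- the enumeration of a one-vertex block [folklore] -/
theorem enumB_singleton {ℓ : ℕ} {prev : Finset (Line d)} {T : Finset (Line d ⊕ Lab d)} (hT : T ∈ I.blocks ℓ prev)
    {v : Line d ⊕ Lab d} (hv : T = {v}) : I.enumB ℓ prev T = [v] := by
  refine list_eq_singleton_of_nodup (I.enumB_spec hT).1 fun x => ?_
  rw [(I.enumB_spec hT).2.1 x, hv, Finset.mem_singleton]

/-- constituents of the component of a lone OLD line [folklore] -/
theorem constit_block_inl (hN : I.NewOK) {ℓ : ℕ} {T : Finset (Line d ⊕ Lab d)} (hT : T ∈ I.blocks ℓ (I.Prev ℓ))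
    {τ : Line d} (h : T = {Sum.inl τ}) : I.hist.constit ℓ (lab (I.newLine ℓ T)) = [Sum.inl (lab τ)] := by
  rw [I.constit_lab_newLine hN hT, I.enumB_singleton hT h]; rfl

/-- constituents of the component of a lone NEW region [folklore] -/
theorem constit_block_inr (hN : I.NewOK) {ℓ : ℕ} {T : Finset (Line d ⊕ Lab d)} (hT : T ∈ I.blocks ℓ (I.Prev ℓ))
    {n : Lab d} (h : T = {Sum.inr n}) : I.hist.constit ℓ (lab (I.newLine ℓ T)) = [Sum.inr n] := by
  rw [I.constit_lab_newLine hN hT, I.enumB_singleton hT h]; rfl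

/-- a block with two distinct vertices gives a constituent list of length `≥ 2` [folklore] -/
theorem two_le_length_constit (hN : I.NewOK) {ℓ : ℕ} {T : Finset (Line d ⊕ Lab d)} (hT : T ∈ I.blocks ℓ (I.Prev ℓ))
    {v w : Line d ⊕ Lab d} (hv : v ∈ T) (hw : w ∈ T) (hne : v ≠ w) :
    2 ≤ (I.hist.constit ℓ (lab (I.newLine ℓ T))).length := by
  rw [I.constit_lab_newLine hN hT, List.length_map]
  exact two_le_length_of_mem_ne (((I.enumB_spec hT).2.1 v).2 hv) (((I.enumB_spec hT).2.1 w).2 hw) hne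

/-- a one-element map singles out the preimage [folklore] -/
theorem map_eq_singleton {α β : Type*} {f : α → β} {l : List α} {b : β} (h : l.map f = [b]) :
    ∃ a, l = [a] ∧ f a = b := by
  match l, h with
  | [], h => simp at h
  | [a], h => simp only [List.map_cons, List.map_nil, List.cons.injEq, and_true] at h; exact ⟨a, rfl, h⟩
  | _ :: _ :: _, h => simp at h

/-- a constituent list `[inl p]` comes from a lone old line labelled `p` [folklore] -/
theorem block_of_constit_inl (hN : I.NewOK) {ℓ : ℕ} {T : Finset (Line d ⊕ Lab d)} (hT : T ∈ I.blocks ℓ (I.Prev ℓ))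
    {p : Lab d} (h : I.hist.constit ℓ (lab (I.newLine ℓ T)) = [Sum.inl p]) : ∃ τ, T = {Sum.inl τ} ∧ lab τ = p := by
  rw [I.constit_lab_newLine hN hT] at h
  obtain ⟨x, hx, hfx⟩ := map_eq_singleton h
  cases x with
  | inr n => simp [toLab] at hfx
  | inl τ =>
      refine ⟨τ, ?_, by simpa [toLab] using hfx⟩
      refine Finset.eq_singleton_iff_unique_mem.2 ⟨((I.enumB_spec hT).2.1 _).1 (by rw [hx]; simp), fun y hy => ?_⟩
      have := ((I.enumB_spec hT).2.1 y).2 hy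
      rw [hx] at this
      simpa using this

/-- a constituent list `[inr n]` comes from a lone new region `n` [folklore] -/
theorem block_of_constit_inr (hN : I.NewOK) {ℓ : ℕ} {T : Finset (Line d ⊕ Lab d)} (hT : T ∈ I.blocks ℓ (I.Prev ℓ))
    {n : Lab d} (h : I.hist.constit ℓ (lab (I.newLine ℓ T)) = [Sum.inr n]) : T = {Sum.inr n} := by
  rw [I.constit_lab_newLine hN hT] at h
  obtain ⟨x, hx, hfx⟩ := map_eq_singleton h
  cases x with
  | inl τ => simp [toLab] at hfx
  | inr m =>
      have hmn : m = n := by simpa [toLab] using hfx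
      subst hmn
      refine Finset.eq_singleton_iff_unique_mem.2 ⟨((I.enumB_spec hT).2.1 _).1 (by rw [hx]; simp), fun y hy => ?_⟩
      have := ((I.enumB_spec hT).2.1 y).2 hy
      rw [hx] at this
      simpa using this

/-- **THE FLAG OF A LIVE LINE'S LABEL IS ITS OWN RENEWAL STATUS** (labels are injective on live lines) [folklore] -/
theorem rnw_lab_iff (hN : I.NewOK) {j : ℕ} {τ : Line d} (hτ : τ ∈ I.St j) : I.rnw j (lab τ) = true ↔ I.Rnw j τ := by
  simp only [rnw, decide_eq_true_eq]
  constructor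
  · rintro ⟨τ', hτ', hl, hr⟩
    rwa [I.lab_injOn_St hN j hτ' hτ hl] at hr
  · exact fun h => ⟨τ, hτ, rfl, h⟩

/-- an old vertex of a block at level `j + 1` is a live, alive line of level `j` [folklore] -/
theorem mem_St_of_inl_mem_block {j : ℕ} {T : Finset (Line d ⊕ Lab d)} (hT : T ∈ I.blocks (j + 1) (I.Prev (j + 1)))
    {τ : Line d} (hτ : Sum.inl τ ∈ T) : τ ∈ I.St j ∧ I.Alive j τ := by
  have h := (I.inl_mem_vert).1 (subset_of_mem_tcomps hT hτ)
  exact ⟨h.1, h.2⟩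

/-! ## §2 The invariant: the construction's (t, E) is the extraction's; live lines are unready since their last event -/

/-- the event case at level `ℓ`: if the block is NOT a lone unrenewed old line, the extracted genealogy has its last
event AT `ℓ` and its last-event domain is the component's domain [folklore] -/
theorem event_case (hN : I.NewOK) {ℓ : ℕ} {T : Finset (Line d ⊕ Lab d)} (hT : T ∈ I.blocks ℓ (I.Prev ℓ))
    (hnone : I.loneOld ℓ T = none) :
    (I.hist.pgenR I.rnw ℓ (lab (I.newLine ℓ T))).lastStep = ℓ ∧
      GeomHistoryR.edomR I.hist I.rnw domL ℓ (lab (I.newLine ℓ T)) = fam (I.P ℓ) T := by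
  set c := lab (I.newLine ℓ T) with hc
  have hc2 : domL ℓ c = fam (I.P ℓ) T := by simp [domL, hc, lab_newLine]
  -- the block is: a single renewed old line, a single new region, or has two distinct vertices
  obtain ⟨v, hv⟩ := nonempty_of_mem_tcomps hT
  by_cases hsing : ∀ w ∈ T, w = v
  · have hTv : T = {v} := Finset.eq_singleton_iff_unique_mem.2 ⟨hv, hsing⟩
    cases v with
    | inl τ =>
        -- a single OLD line: it must be renewed (else `loneOld` would be `some`)
        have hR : I.Rnw (ℓ - 1) τ := by
          by_contra hnr
          rw [hTv, I.loneOld_singleton hnr] at hnone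
          exact Option.some_ne_none _ hnone
        cases ℓ with
        | zero => exact absurd (subset_of_mem_tcomps hT hv) (I.not_inl_mem_vert_zero τ)
        | succ j =>
            have hτ := (I.mem_St_of_inl_mem_block hT (hTv ▸ Finset.mem_singleton_self _)).1
            have hcs := I.constit_block_inl hN hT hTv
            have hflag : I.rnw j (lab τ) = true := (I.rnw_lab_iff hN hτ).2 hR
            refine ⟨by rw [hc, I.hist.pgenR_succ_renew I.rnw j _ _ hcs hflag]; rfl, ?_⟩
            rw [← hc2, hc]
            exact GeomHistoryR.edomR_succ_event I.hist I.rnw domL (by rw [hcs]; simp [lonePartR, hflag])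
    | inr n =>
        have hcs := I.constit_block_inr hN hT hTv
        cases ℓ with
        | zero =>
            refine ⟨by rw [hc, I.hist.pgenR_zero_birth I.rnw _ _ hcs]; rfl, ?_⟩
            rw [← hc2, hc]; rfl
        | succ j =>
            refine ⟨by rw [hc, I.hist.pgenR_succ_birth I.rnw j _ _ hcs]; rfl, ?_⟩
            rw [← hc2, hc]
            exact GeomHistoryR.edomR_succ_event I.hist I.rnw domL (by rw [hcs]; simp [lonePartR])
  · -- two distinct vertices: a join chain at `ℓ`
    obtain ⟨w, hw'⟩ := not_forall.1 hsing
    obtain ⟨hw, hwv⟩ := Classical.not_imp.1 hw'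
    have h2 : 2 ≤ (I.hist.constit ℓ c).length := I.two_le_length_constit hN hT hw hv hwv
    cases ℓ with
    | zero =>
        refine ⟨?_, by rw [← hc2, hc]; rfl⟩
        rw [I.hist.pgenR_zero_eq I.rnw]
        refine lastStep_assembleR_of_two_le _ _ ?_
        have hl0 : (I.hist.parts 0 c).length = 0 := by rw [(I.wf_hist hN).parts_zero c]; rfl
        have hsum := length_lefts_add_length_rights (I.hist.constit 0 c)
        rw [ComponentHistory.length_births]
        simp only [ComponentHistory.parts] at hl0
        simp only [ComponentHistory.news]
        omega
    | succ j =>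
        refine ⟨?_, ?_⟩
        · rw [I.hist.pgenR_succ_eq I.rnw]
          refine lastStep_assembleR_of_two_le _ _ ?_
          rw [ComponentHistory.length_constituentsR, ComponentHistory.parts, ComponentHistory.news,
            length_lefts_add_length_rights]
          exact h2
        · rw [← hc2, hc]
          exact GeomHistoryR.edomR_succ_event I.hist I.rnw domL (lonePartR_eq_none_of_two_le _ _ (hc ▸ h2))

/-- **THE INVARIANT.**  For every line live at level `ℓ`: `t ≤ ℓ`; `t` is the last step and `E` the last-event domain
of the EXTRACTED genealogy of its label; and the line has not been ready at any scale strictly between its last event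
and `ℓ`. [folklore] -/
theorem inv (hN : I.NewOK) : ∀ (ℓ : ℕ), ∀ τ' ∈ I.St ℓ,
    τ'.t ≤ ℓ ∧ τ'.t = (I.hist.pgenR I.rnw ℓ (lab τ')).lastStep ∧
      τ'.E = GeomHistoryR.edomR I.hist I.rnw domL ℓ (lab τ') ∧
        ∀ k, k < ℓ - τ'.t → ¬ Stops I.L I.s I.R τ'.t τ'.E k := by
  intro ℓ
  induction ℓ with
  | zero =>
      intro τ' hτ'
      obtain ⟨T, hT, rfl⟩ := (I.mem_St_iff).1 hτ'
      -- at level 0 every block is an event (no old lines)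
      have hnone : I.loneOld 0 T = none := by
        by_contra hs
        obtain ⟨τ, hs⟩ := Option.ne_none_iff_exists'.1 hs
        obtain ⟨hTe, -⟩ := I.eq_of_loneOld_eq_some hs
        exact I.not_inl_mem_vert_zero τ (subset_of_mem_tcomps hT (hTe ▸ Finset.mem_singleton_self _))
      obtain ⟨hlast, hedom⟩ := I.event_case hN hT hnone
      have hnl : I.newLine 0 T = ⟨fam (I.P 0) T, 0, fam (I.P 0) T⟩ := by unfold newLine; rw [hnone]
      refine ⟨by rw [hnl], by rw [hlast, hnl], by rw [hedom, hnl], fun k hk => ?_⟩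
      rw [hnl] at hk
      simp at hk
  | succ j ih =>
      intro τ' hτ'
      obtain ⟨T, hT, rfl⟩ := (I.mem_St_iff).1 hτ'
      cases hlo : I.loneOld (j + 1) T with
      | none =>
          obtain ⟨hlast, hedom⟩ := I.event_case hN hT hlo
          have hnl : I.newLine (j + 1) T = ⟨fam (I.P (j + 1)) T, j + 1, fam (I.P (j + 1)) T⟩ := by
            unfold newLine; rw [hlo]
          refine ⟨by rw [hnl], by rw [hlast, hnl], by rw [hedom, hnl], fun k hk => ?_⟩
          rw [hnl] at hk
          simp at hk
      | some τ =>
          -- a lone UNRENEWED old line: no event, everything inherited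
          obtain ⟨hTe, hnr⟩ := I.eq_of_loneOld_eq_some hlo
          have hnl : I.newLine (j + 1) T = ⟨fam (I.P (j + 1)) T, τ.t, τ.E⟩ := by unfold newLine; rw [hlo]
          obtain ⟨hτ, halive⟩ := I.mem_St_of_inl_mem_block hT (hTe ▸ Finset.mem_singleton_self _)
          obtain ⟨ht, hlast, hedom, hfirst⟩ := ih τ hτ
          have hcs := I.constit_block_inl hN hT hTe
          have hflag : I.rnw j (lab τ) = false := by
            simpa using (show ¬ (I.rnw j (lab τ) = true) from fun h => hnr ((I.rnw_lab_iff hN hτ).1 h))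
          have hpg : I.hist.pgenR I.rnw (j + 1) (lab (I.newLine (j + 1) T)) = I.hist.pgenR I.rnw j (lab τ) :=
            I.hist.pgenR_succ_lone I.rnw j _ _ hcs hflag
          have hed : GeomHistoryR.edomR I.hist I.rnw domL (j + 1) (lab (I.newLine (j + 1) T)) =
              GeomHistoryR.edomR I.hist I.rnw domL j (lab τ) :=
            GeomHistoryR.edomR_succ_lone I.hist I.rnw domL hcs hflag
          have hunready : ¬ Stops I.L I.s I.R τ.t τ.E (j - τ.t) := I.not_rdy_of_alive_not_rnw halive hnr
          refine ⟨by rw [hnl]; exact ht.trans (Nat.le_succ j), by rw [hpg, hnl]; exact hlast,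
            by rw [hed, hnl]; exact hedom, fun k hk => ?_⟩
          rw [hnl] at hk ⊢
          simp only at hk ⊢
          by_cases hkj : k < j - τ.t
          · exact hfirst k hkj
          · have : k = j - τ.t := by omega
            rw [this]; exact hunready

/-! ## §3 The clauses hold for the construction -/

/-- **THE DISPLAYED CLAUSES HOLD FOR PRINT'S CONSTRUCTION** (under the input condition `NewOK`). [folklore] -/
theorem levelClausesR_hist (hN : I.NewOK) : GeomHistoryR.LevelClausesR I.hist I.rnw domL I.L I.s I.R where
  new_ok ℓ n hn := hN.ok ℓ n hn
  dom_birth ℓ c n hc hcs := by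
    obtain ⟨T, hT, rfl⟩ := I.mem_comp_iff.1 hc
    have hTe := I.block_of_constit_inr hN hT hcs
    simp [domL, lab_newLine, hTe, P]
  dom_flow j c p hc hcs := by
    obtain ⟨T, hT, rfl⟩ := I.mem_comp_iff.1 hc
    obtain ⟨τ, hTe, hp⟩ := I.block_of_constit_inl hN hT hcs
    subst hp
    simp [domL, hTe, P, lab]
  ready j c hc p hp hflag := by
    obtain ⟨T, hT, rfl⟩ := I.mem_comp_iff.1 hc
    obtain ⟨τ, hτT, rfl⟩ := (I.mem_parts_iff hN hT).1 hp
    obtain ⟨hτ, -⟩ := I.mem_St_of_inl_mem_block hT hτT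
    obtain ⟨-, hlast, hedom, hfirst⟩ := I.inv hN j τ hτ
    have hR : I.Rnw j τ := (I.rnw_lab_iff hN hτ).1 hflag
    rw [← hlast, ← hedom]
    exact ⟨hR.1, hfirst⟩
  pend j c hc _ p hp hflag := by
    obtain ⟨T, hT, rfl⟩ := I.mem_comp_iff.1 hc
    obtain ⟨τ, hτT, rfl⟩ := (I.mem_parts_iff hN hT).1 hp
    obtain ⟨hτ, halive⟩ := I.mem_St_of_inl_mem_block hT hτT
    obtain ⟨ht, hlast, hedom, hfirst⟩ := I.inv hN j τ hτ
    have hnr : ¬ I.Rnw j τ := fun h => by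
      have := (I.rnw_lab_iff hN hτ).2 h
      rw [hflag] at this
      exact Bool.false_ne_true this
    have hunready : ¬ Stops I.L I.s I.R τ.t τ.E (j - τ.t) := I.not_rdy_of_alive_not_rnw halive hnr
    rw [← hlast, ← hedom]
    refine ⟨ht.trans (Nat.le_succ j), fun k hk => ?_⟩
    by_cases hkj : k < j - τ.t
    · exact hfirst k hkj
    · have : k = j - τ.t := by omega
      rw [this]; exact hunready
  touch ℓ c hc _ := by
    obtain ⟨T, hT, rfl⟩ := I.mem_comp_iff.1 hc
    rw [I.constit_lab_newLine hN hT, List.map_map]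
    have : imgC I.L I.s domL ℓ ∘ toLab = I.P ℓ := funext fun x => (I.P_eq_imgC ℓ x).symm
    rw [this]
    exact (I.enumB_spec hT).2.2
  dom_join ℓ c hc _ := by
    obtain ⟨T, hT, rfl⟩ := I.mem_comp_iff.1 hc
    rw [I.constit_lab_newLine hN hT, List.map_map]
    have : imgC I.L I.s domL ℓ ∘ toLab = I.P ℓ := funext fun x => (I.P_eq_imgC ℓ x).symm
    rw [this]
    intro x hx
    simp only [domL, lab_newLine] at hx
    obtain ⟨v, hv, hxv⟩ := mem_fam.1 hx
    exact mem_unionL.2 ⟨I.P ℓ v, List.mem_map.2 ⟨v, ((I.enumB_spec hT).2.1 v).2 hv, rfl⟩, hxv⟩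

/-! ## §4 Every component's pedigree is print-exactly realised; current domains are orbits and pairwise disjoint -/

/-- **EVERY COMPONENT OF PRINT'S CONSTRUCTION IS PRINT-EXACTLY REALISED**: for every `c ∈ comp ℓ`,
`RealisesP L s R (pgenR ℓ c) (edomR ℓ c)` and its current domain `c.2` is the orbit of the last-event domain from
the last step (under the input condition `NewOK` only). [folklore] -/
theorem realisesP_hist (hN : I.NewOK) {ℓ : ℕ} {c : Lab d} (hc : c ∈ I.hist.comp ℓ) :
    RealisesP I.L I.s I.R (I.hist.pgenR I.rnw ℓ c) (GeomHistoryR.edomR I.hist I.rnw domL ℓ c) ∧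
      c.2 = orbit I.L I.s (I.hist.pgenR I.rnw ℓ c).lastStep (GeomHistoryR.edomR I.hist I.rnw domL ℓ c)
        (ℓ - (I.hist.pgenR I.rnw ℓ c).lastStep) :=
  realisesP_pgenR (I.wf_hist hN) (I.levelClausesR_hist hN) ℓ c hc

/-- **DISTINCT COMPONENTS OF ONE LEVEL HAVE DISJOINT CURRENT DOMAINS** (= orbits of their last-event domains).
[folklore] -/
theorem disjoint_orbits_hist (hN : I.NewOK) {K : ℕ} {c c' : Lab d} (hc : c ∈ I.hist.comp K) (hc' : c' ∈ I.hist.comp K)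
    (hne : c ≠ c') :
    Disjoint (orbit I.L I.s (I.hist.pgenR I.rnw K c).lastStep (GeomHistoryR.edomR I.hist I.rnw domL K c)
        (K - (I.hist.pgenR I.rnw K c).lastStep))
      (orbit I.L I.s (I.hist.pgenR I.rnw K c').lastStep (GeomHistoryR.edomR I.hist I.rnw domL K c')
        (K - (I.hist.pgenR I.rnw K c').lastStep)) := by
  refine disjoint_orbit_of_disjoint_domR (I.wf_hist hN) (I.levelClausesR_hist hN) hc hc' ?_
  obtain ⟨τ, hτ, rfl⟩ := Finset.mem_image.1 hc
  obtain ⟨τ', hτ', rfl⟩ := Finset.mem_image.1 hc'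
  have hne' : τ ≠ τ' := fun h => hne (by rw [h])
  simpa [domL, lab] using (I.St_nonempty_disjoint hN K).2 τ hτ τ' hτ' hne'

/-- the pedigree of every component obeys print's timing discipline `Adm` at its level [folklore] -/
theorem adm_hist (hN : I.NewOK) {ℓ : ℕ} {c : Lab d} (hc : c ∈ I.hist.comp ℓ) : (I.hist.pgenR I.rnw ℓ c).Adm ℓ :=
  adm_of_mem_compR (I.wf_hist hN) (I.levelClausesR_hist hN) hc

end RunInput

end

end Summit.QuantumFields.BalabanUV.T4Continuum.HistoryGenealogyInstantiate
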